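import Summits.AtomisticToContinuum.FouriersLaw.Theorems.BondHeatUncertaintySubdiffusiveBondHeatAffineCorrectorCeiling
import Summits.AtomisticToContinuum.FouriersLaw.Theorems.BondHeatUncertaintySubdiffusiveBondHeatCovariantStatics

/-!
# `KineticCorrectorBudget` ladder — the SCALING-COVARIANT affine ceiling for `N ≥ 2` (decomp-a2c hand-2 g19, critic row 691 (b))

`covariantCorrectorCeiling_two : ∀ ω₂ lam β γ > 0, ∃ b, ∀ T > 0, ∀ N ≥ 2, ∀ τ ≥ 0, ‖g^τ_{N,T}‖² ≤ (2T²/γ)·τ + b·T²` — the `N ≥ 2` form of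
the rung `CovariantCorrectorCeiling` of `…AnharmonicityWindowLadder` (lens-1 g54), exactly as hand-1 g18's `affineCorrectorCeiling_two`
(VERBATIM route: conditional Jensen + second moment of the time integral + the landed bath-bond reduction) with the static input
`E[e₀²] ≤ σ²(T)` (`localEnergyMoment`) replaced by the `T`-COVARIANT statics `E[e₀²] ≤ b·T²` (`…CovariantStatics.siteEnergy_sq_le_covariant`),
so `B(T) = 4σ²/γ² = (4b/γ²)·T²`.  No definitions, no `sorry`, standard axioms.  `--supports stmt-AtomisticToContinuum-9120`.
-/

noncomputable section

open MeasureTheory ProbabilityTheory Set Filter Topology intervalIntegral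
open scoped NNReal

namespace Summit.AtomisticToContinuum.FouriersLaw.Theorems.SubdiffusiveBondHeat.CorrectorBudget.Ladder

open Literature.MathematicalPhysics.KineticTheory.HeatConduction
open Literature.Probability.Process
open Summit.AtomisticToContinuum.FouriersLaw.Theorems.SubdiffusiveBondHeat
open Summit.AtomisticToContinuum.FouriersLaw.Theorems.LightConeBondHeat (pinnedChain_bondHeatVar_nonneg)

/-- ★★ **THE SCALING-COVARIANT AFFINE CEILING, `N ≥ 2`**: `∃ b = b(ω₂, lam, β, γ), ∀ T > 0, ∀ N ≥ 2, ∀ τ ≥ 0,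
‖g^τ_{N,T}‖² ≤ (2T²/γ)·τ + b·T²` (`b = 4·b_stat/γ²` with `b_stat` from `siteEnergy_sq_le_covariant`). [this file] -/
theorem covariantCorrectorCeiling_two :
    ∀ ω₂ lam β γ : ℝ, 0 < ω₂ → 0 < lam → 0 < β → 0 < γ →
      ∃ b : ℝ, ∀ T : ℝ, 0 < T → ∀ N : ℕ, 2 ≤ N → ∀ τ : ℝ, 0 ≤ τ →
        correctorNormSq ω₂ lam β γ T N τ ≤ 2 * T ^ 2 / γ * τ + b * T ^ 2 := by
  intro ω₂ lam β γ hω hl hβ hγ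
  obtain ⟨b, hb⟩ := siteEnergy_sq_le_covariant ω₂ lam β γ hω hl hβ hγ
  refine ⟨4 * b / γ ^ 2, fun T hT N hN2 τ hτ => ?_⟩
  set σ2 : ℝ := b * T ^ 2 with hσ2def
  have hσ : ∀ (N : ℕ) (hN : 1 < N), _ := fun N hN => hb T hT N hN
  have hN : 1 < N := by omega
  have hN0 : 0 < N := Nat.zero_lt_of_lt hN
  unfold correctorNormSq
  rw [dif_pos hN0]
  set P := pinnedChain ω₂ lam β γ with hP
  -- the boundary kernel `K_N`, its iterated primitive, and the Cesàro deficit `W_N`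
  set K : ℝ → ℝ := fun u => ∫ z, ((z.2 ⟨0, hN0⟩) ^ 2 - T) *
      (∫ y, ((y.2 ⟨0, hN0⟩) ^ 2 - T) ∂(P.transitionKernel N T T u.toNNReal z)) ∂(P.gibbsMeasure N T) with hK
  set F : ℝ → ℝ := fun s => ∫ u in (0 : ℝ)..s, K u with hF
  -- (a) conditional Jensen + (b) second moment of the time integral = `2∫(τ−r)K = 2∫F`
  have hJ := correctorNormSq_le_timeIntegral_sq hω hl hβ hγ hT hN0 hτ
  have hinv : ∀ s : ℝ≥0, (P.gibbsMeasure N T).bind (P.transitionKernel N T T s) = P.gibbsMeasure N T := fun s =>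
    pinnedChain_gibbsMeasure_bind_transitionKernel hω hl.le hβ.le hγ.le hN0 hT s
  haveI : IsProbabilityMeasure (P.gibbsMeasure N T) := pinnedChain_isProbabilityMeasure_gibbsMeasure hω hl.le hβ.le γ N hT
  have hKm : Measurable (fun y : PhaseSpace N => (y.2 ⟨0, hN0⟩) ^ 2 - T) := by fun_prop
  have hK2 := pinnedChain_integrable_sq_kinObs₀ (γ := γ) hω hl hβ hT hN0
  have hsq := pinnedChain_timeIntegral_sq ω₂ lam β γ hω hl.le hβ.le hγ.le N T T (P.gibbsMeasure N T) hinv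
    (fun y : PhaseSpace N => (y.2 ⟨0, hN0⟩) ^ 2 - T) hKm hK2 τ hτ
  have htri := pinnedChain_primitive_kinKernel_integral_eq (γ := γ) hω hl hβ hγ hT hN0 hτ
  -- so `‖g^τ‖² ≤ 2 ∫₀^τ F`
  have h1 : ∫ z, (∫ u in (0 : ℝ)..τ, ∫ y, ((y.2 ⟨0, hN0⟩) ^ 2 - T)
        ∂(P.transitionKernel N T T u.toNNReal z)) ^ 2 ∂(P.gibbsMeasure N T) ≤ 2 * ∫ s in (0 : ℝ)..τ, F s := by
    have h := hJ.trans_eq hsq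
    rw [← htri] at h
    simpa only [hF, hK] using h
  -- (c) the bath-bond reduction `0 ≤ V_N(0,τ) ≤ 4γT²·W_N(τ) + 8E[e₀²]`, `E[e₀²] ≤ σ²`
  have hred := stub_bathBondReduction_of_kernelFacts ω₂ lam β γ hω hl hβ hγ T hT N hN
    (stub_kernelDetailedBalance ω₂ lam β γ hω hl hβ hγ T hT N hN)
    (stub_siteEnergyDynkin ω₂ lam β γ hω hl hβ hγ T hT N hN)
    (stub_siteEnergyCurrentCovariance ω₂ lam β γ hω hl hβ hγ T hT N hN) τ hτ
  have hV0 := pinnedChain_bondHeatVar_nonneg hω hl.le hβ hγ hN0 hT ⟨0, hN0⟩ hτ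
  have hmom := hσ N hN
  -- `W_N(τ) = τ − (γ/T²)∫₀^τ F`
  obtain ⟨-, hKc, -, -, -⟩ := boundaryKernelBasics_proof ω₂ lam β γ hω hl hβ hγ T hT N hN0
  simp only [dif_pos hN0] at hKc
  have hFc : Continuous F := intervalIntegral.continuous_primitive (fun a b => hKc.intervalIntegrable a b) 0
  have hFi : IntervalIntegrable F volume 0 τ := hFc.intervalIntegrable 0 τ
  have hFi' : IntervalIntegrable (fun s => γ / T ^ 2 * F s) volume 0 τ := hFi.const_mul _
  have hsplit : ∫ s in (0 : ℝ)..τ, (1 - γ / T ^ 2 * F s) = τ - γ / T ^ 2 * ∫ s in (0 : ℝ)..τ, F s := by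
    rw [intervalIntegral.integral_sub intervalIntegrable_const hFi', intervalIntegral.integral_const,
      intervalIntegral.integral_const_mul, sub_zero, smul_eq_mul, mul_one]
  have hW : 2 * (∫ s in (0:ℝ)..τ, (τ - s) * ∫ z, P.bondCurrent N ⟨0, hN0⟩ z *
        (∫ y, P.bondCurrent N ⟨0, hN0⟩ y ∂(P.transitionKernel N T T s.toNNReal z)) ∂(P.gibbsMeasure N T)) ≤
      4 * γ * T ^ 2 * (τ - γ / T ^ 2 * ∫ s in (0 : ℝ)..τ, F s) + 8 * σ2 := by
    have h := hred
    rw [show (∫ s in (0 : ℝ)..τ, (1 - γ / T ^ 2 * ∫ u in (0 : ℝ)..s,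
        ∫ z, ((z.2 ⟨0, Nat.zero_lt_of_lt hN⟩) ^ 2 - T) *
          (∫ y, ((y.2 ⟨0, Nat.zero_lt_of_lt hN⟩) ^ 2 - T) ∂(P.transitionKernel N T T u.toNNReal z))
            ∂(P.gibbsMeasure N T))) = τ - γ / T ^ 2 * ∫ s in (0 : ℝ)..τ, F s from hsplit] at h
    linarith
  -- combine: `(γ/T²)·∫F ≤ ... `
  have hγT : 0 < γ / T ^ 2 := div_pos hγ (by positivity)
  have hT2 : 0 < T ^ 2 := by positivity
  -- from `0 ≤ V ≤ 4γT²(τ − (γ/T²)∫F) + 8σ²`: `4γ²·∫F ≤ 4γT²τ + 8σ²`, i.e. `2∫F ≤ (2T²/γ)τ + 4σ²/γ²`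
  have hkey : 2 * ∫ s in (0 : ℝ)..τ, F s ≤ 2 * T ^ 2 / γ * τ + 4 * σ2 / γ ^ 2 := by
    have h0 : 0 ≤ 4 * γ * T ^ 2 * (τ - γ / T ^ 2 * ∫ s in (0 : ℝ)..τ, F s) + 8 * σ2 := hV0.trans hW
    have ha : T ^ 2 * (γ / T ^ 2 * ∫ s in (0 : ℝ)..τ, F s) = γ * ∫ s in (0 : ℝ)..τ, F s := by
      field_simp
    have h0' : 0 ≤ 4 * γ * T ^ 2 * τ - 4 * γ ^ 2 * (∫ s in (0 : ℝ)..τ, F s) + 8 * σ2 := by nlinarith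
    have hγ2 : 0 < γ ^ 2 := by positivity
    have h3 : 2 * (∫ s in (0 : ℝ)..τ, F s) * γ ^ 2 ≤ (2 * T ^ 2 / γ * τ + 4 * σ2 / γ ^ 2) * γ ^ 2 := by
      have e : (2 * T ^ 2 / γ * τ + 4 * σ2 / γ ^ 2) * γ ^ 2 = 2 * γ * T ^ 2 * τ + 4 * σ2 := by
        field_simp
      rw [e]
      nlinarith
    exact le_of_mul_le_mul_right h3 hγ2
  have hfin : 2 * T ^ 2 / γ * τ + 4 * σ2 / γ ^ 2 = 2 * T ^ 2 / γ * τ + 4 * b / γ ^ 2 * T ^ 2 := by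
    rw [hσ2def]; ring
  exact h1.trans (hkey.trans_eq hfin)

end Summit.AtomisticToContinuum.FouriersLaw.Theorems.SubdiffusiveBondHeat.CorrectorBudget.Ladder
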